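import Literature.Barriers.CriticalPhenomena.WeaklySAWQuadraticFlowCutoffShift
import Literature.Barriers.CriticalPhenomena.WeaklySAWCutoffMassStability
import Literature.Barriers.CriticalPhenomena.WeaklySAWPerturbativeA2
import HarnessLib

/-!
# BBS 2015, §7.3 (Step 2 of the proof of Proposition 7.1.1): the hypotheses of
# [BBS-rg-flow, Lemmas 2.1–2.2] for `φ̄(m²)` of the 4d weakly SAW with the weights FROZEN at the
# cut-off of a nearby mass `m̃²`

Source: Bauerschmidt–Brydges–Slade, CMP 337 (2015) [BBS2015], §7.3: the flow theorem (Theorem 7.2.1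
= [BBS-rg-flow, Theorem 1.4]) is applied "with a single value `(m̃², g̃₀)`", the domains (Djdef-2)
being defined "with `χ̃_j = χ_j(m̃²)`", and the resulting local solutions for `(m², g₀)` in a
neighbourhood of `(m̃², g̃₀)` are then patched together (Steps 2–3). For this the hypotheses (A1)–(A2)
of the flow theorem must hold for `φ̄(m²)` relative to the FROZEN weights `χ̃`. In this tree the flow
theorem at a general cut-off is `BBS_thm14_exists_flow_cutoff` (hypothesis `CutoffQuadHyp P Ω k …`),
and this file supplies that hypothesis for `P = wsawQuadFlow L m²` at the frozen cut-off
`k̃ = j_Ω(β(m̃²))`, for all `m²` with `|m² - m̃²| ≤ ½m̃²`: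
(A1)–(A2) at `m²` (`hypA1_and_hypA2_wsawQuadFlow`) ⟹ `CutoffQuadHyp` at `j_Ω(β(m²))`
(`cutoffQuadHyp_of_hypA`) ⟹ at `k̃` by the cut-off shift (`CutoffQuadHyp.shift`, with
`|j_Ω(β(m²)) - j_Ω(β(m̃²))| ≤ D` from `jOmega_betaPT_sub_le`) ⟹ with `N = ⌊c'⁻¹⌋₊` exceptional
scales for a smaller `c'` (`CutoffQuadHyp.weaken`), as `BBS_thm14_exists_flow_cutoff` wants.

* `CutoffGbarHyp.weaken`, `CutoffQuadHyp.weaken` — decreasing `c` and increasing `N` (smallness for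
  the new constants assumed);
* `HypA1.mono`, `HypA2.mono` — (A1)–(A2) are monotone in the constants (`B ↑`, `c ↓`, `C ↑`);
* **`cutoffQuadHyp_wsaw_frozen`** — `∃ δ, B', c', C', g_* > 0` such that (A1)–(A2) hold with the
  constants `(B', c', C')` at every `m² ∈ [0, δ]`, and for all `m̃², m² ∈ (0, δ]` with
  `|m² - m̃²| ≤ ½m̃²` and all `g₀ ∈ (0, g_*]`:
  `CutoffQuadHyp (wsawQuadFlow L m²) Ω (j_Ω(β(m̃²))) B' c' ⌊c'⁻¹⌋₊ C' L² g₀` (the SAME constants, as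
  the fixed-cut-off Corollary 1.8 `critFlowK_continuousWithinAt` wants).
-/

noncomputable section

open Set

namespace Literature.Barriers.CriticalPhenomena

namespace CTWSAW

/-! ### Weakening `c` and `N` -/

/-- `CutoffGbarHyp` is monotone in `(c ↓, N ↑)` (given the smallness for the new `N`).
[cite: BauerschmidtBrydgesSlade2015Flow, Assumption (A1) and Lemma 2.1] -/
theorem CutoffGbarHyp.weaken {β : ℕ → ℝ} {Ω : ℝ} {k : ℕ∞} {B c : ℝ} {N : ℕ} {g₀ : ℝ}
    (h : CutoffGbarHyp β Ω k B c N g₀) {c' : ℝ} {N' : ℕ} (hc' : 0 < c') (hc'c : c' ≤ c) (hN : N ≤ N')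
    (hsmallN : 2 * B * g₀ * (N' + 1 / (Ω - 1)) ≤ 1 / 2) : CutoffGbarHyp β Ω k B c' N' g₀ where
  one_lt := h.one_lt
  abs_le := h.abs_le
  c_pos := hc'
  exc := by
    obtain ⟨s, hs, hP⟩ := h.exc
    exact ⟨s, hs.trans hN, fun j hj hjs => hc'c.trans (hP j hj hjs)⟩
  g₀_pos := h.g₀_pos
  g₀_le := h.g₀_le
  smallB := h.smallB
  smallN := hsmallN

/-- `CutoffQuadHyp` is monotone in `(c ↓, N ↑)` (given the smallness for the new constants).
[cite: BauerschmidtBrydgesSlade2015Flow, Assumptions (A1)–(A2) and Lemma 2.2] -/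
theorem CutoffQuadHyp.weaken {P : QuadFlowParams} {Ω : ℝ} {k : ℕ∞} {B c : ℝ} {N : ℕ} {C lam g₀ : ℝ}
    (h : CutoffQuadHyp P Ω k B c N C lam g₀) {c' : ℝ} {N' : ℕ} (hc' : 0 < c') (hc'c : c' ≤ c)
    (hN : N ≤ N') (hsmallN : 2 * B * g₀ * (N' + 1 / (Ω - 1)) ≤ 1 / 2)
    (hsmallC2 : 8 * C * g₀ * (N' + 1 / (Ω - 1)) ≤ 1)
    (hsmallτ : 2 * C * g₀ * (1 + 2 * C * ((1 + N') / c' + N' + 2 * Ω / (Ω - 1))) ≤ (lam - 1) / 2) :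
    CutoffQuadHyp P Ω k B c' N' C lam g₀ :=
  { toCutoffGbarHyp := h.toCutoffGbarHyp.weaken hc' hc'c hN hsmallN
    one_lt_lam := h.one_lt_lam
    lam_le := h.lam_le
    C_nonneg := h.C_nonneg
    zeta_exc := by
      obtain ⟨s, hs, hP⟩ := h.zeta_exc
      exact ⟨s, hs.trans hN, hP⟩
    eta_le := h.eta_le
    gamma_le := h.gamma_le
    theta_le := h.theta_le
    zeta_le := h.zeta_le
    υgg_le := h.υgg_le
    υgz_le := h.υgz_le
    υgμ_le := h.υgμ_le
    υzz_le := h.υzz_le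
    υzμ_le := h.υzμ_le
    smallC1 := h.smallC1
    smallC2 := hsmallC2
    smallτ := hsmallτ }

/-- Smallness bookkeeping: `Kg ≤ r` as soon as `g ≤ r/(K+1)` (`K, g ≥ 0`, `r > 0`). [folklore] -/
theorem mul_le_of_le_div_add_one {K g r : ℝ} (hK : 0 ≤ K) (hr : 0 < r) (h : g ≤ r / (K + 1)) :
    K * g ≤ r := by
  have h1 : K * g ≤ K * (r / (K + 1)) := mul_le_mul_of_nonneg_left h hK
  have h2 : K * (r / (K + 1)) ≤ r := by
    rw [mul_div_assoc', div_le_iff₀ (by positivity)]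
    nlinarith
  exact h1.trans h2

/-- `⌊c'⁻¹⌋₊ ≥ n` for `c' ≤ 1/(n+1)` (`c' > 0`). [folklore] -/
theorem le_floor_inv_of_le {c' : ℝ} {n : ℕ} (hc' : 0 < c') (h : c' ≤ 1 / (n + 1)) : n ≤ ⌊c'⁻¹⌋₊ := by
  refine Nat.le_floor ?_
  have : (n : ℝ) + 1 ≤ c'⁻¹ := by
    rw [le_inv_comm₀ (by positivity) hc']
    simpa [one_div] using h
  linarith

/-- Two positive thresholds have a common positive lower bound. [folklore] -/
theorem exists_pos_le_both {a b : ℝ} (ha : 0 < a) (hb : 0 < b) : ∃ g : ℝ, 0 < g ∧ g ≤ a ∧ g ≤ b :=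
  ⟨min a b, lt_min ha hb, min_le_left _ _, min_le_right _ _⟩

/-! ### Monotonicity of (A1)–(A2) in the constants -/

/-- (A1) is monotone in the constants: `B ≤ B'`, `0 < c' ≤ c`. [cite: BauerschmidtBrydgesSlade2015Flow, Assumption (A1)] -/
theorem HypA1.mono {β : ℕ → ℝ} {Ω B c B' c' : ℝ} (h : HypA1 β Ω B c) (hB : B ≤ B') (hc' : 0 < c')
    (hc'c : c' ≤ c) : HypA1 β Ω B' c' where
  abs_le j := (h.abs_le j).trans hB
  c_pos := hc'
  exc := by
    obtain ⟨s, hs, hP⟩ := h.exc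
    exact ⟨s, hs.trans ((inv_le_inv₀ h.c_pos hc').2 hc'c), fun j hj hjs => hc'c.trans (hP j hj hjs)⟩

/-- (A2) is monotone in the constants: `0 < c' ≤ c`, `C ≤ C'`. [cite: BauerschmidtBrydgesSlade2015Flow, Assumption (A2)] -/
theorem HypA2.mono {P : QuadFlowParams} {Ω lam c C c' C' : ℝ} (h : HypA2 P Ω lam c C) (hΩ : 1 ≤ Ω)
    (hc' : 0 < c') (hc'c : c' ≤ c) (hC : C ≤ C') : HypA2 P Ω lam c' C' := by
  have hmono : ∀ {u : ℝ} (j : ℕ), |u| ≤ C * chi P.β Ω j → |u| ≤ C' * chi P.β Ω j := fun j hu =>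
    hu.trans (mul_le_mul_of_nonneg_right hC (chi_pos_and_le_one P.β hΩ j).1.le)
  exact
    { one_lt_lam := h.one_lt_lam
      lam_le := h.lam_le
      c_pos := hc'
      zeta_exc := by
        obtain ⟨s, hs, hP⟩ := h.zeta_exc
        exact ⟨s, hs.trans ((inv_le_inv₀ h.c_pos hc').2 hc'c), hP⟩
      eta_le := fun j => hmono j (h.eta_le j)
      gamma_le := fun j => hmono j (h.gamma_le j)
      theta_le := fun j => hmono j (h.theta_le j)
      zeta_le := fun j => hmono j (h.zeta_le j)
      υgg_le := fun j => hmono j (h.υgg_le j)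
      υgz_le := fun j => hmono j (h.υgz_le j)
      υgμ_le := fun j => hmono j (h.υgμ_le j)
      υzz_le := fun j => hmono j (h.υzz_le j)
      υzμ_le := fun j => hmono j (h.υzμ_le j) }

/-! ### The frozen cut-off for the weakly self-avoiding walk -/

/-- **(A1)–(A2) for `φ̄(m²)` with the weights frozen at the cut-off of a nearby mass** (BBS 2015, §7.3,
input of Step 2): for `L ≥ 2`, `Ω > 1` there are `δ ∈ (0,1]`, constants `B', c', C'` and `g_* > 0`
such that (A1)–(A2) hold with the constants `(B', c', C')` at every `m² ∈ [0,δ]`, and for all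
`m̃², m² ∈ (0,δ]` with `|m² - m̃²| ≤ ½m̃²` and all `g₀ ∈ (0, g_*]`, the hypotheses of
[BBS-rg-flow, Lemmas 2.1–2.2] hold for `wsawQuadFlow L m²` at the FROZEN cut-off `k̃ = j_Ω(β(m̃²))`,
with `N = ⌊c'⁻¹⌋₊` exceptional scales and `λ = L²` — the hypothesis of `BBS_thm14_exists_flow_cutoff`.
[cite: BauerschmidtBrydgesSlade2015LogCorr, §7.3 (proof of Proposition 7.1.1: Theorem 7.2.1 applied "with a single value (m̃²,g̃₀)", (Djdef-2) "with χ̃_j = χ_j(m̃²)")] [cite: BauerschmidtBrydgesSlade2015Flow, Assumptions (A1)–(A2), §1.2 ("the value of j_Ω is not important")] -/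
theorem cutoffQuadHyp_wsaw_frozen {L : ℝ} (hL : 2 ≤ L) {Ω : ℝ} (hΩ : 1 < Ω) :
    ∃ δ B' c' C' gs : ℝ, 0 < δ ∧ δ ≤ 1 ∧ 0 < c' ∧ 0 < gs ∧
      (∀ s : ℝ, 0 ≤ s → s ≤ δ →
        HypA1 (wsawQuadFlow L s).β Ω B' c' ∧ HypA2 (wsawQuadFlow L s) Ω (L ^ 2) c' C') ∧
      ∀ s0 s : ℝ, 0 < s0 → s0 ≤ δ → 0 < s → s ≤ δ → |s - s0| ≤ 1 / 2 * s0 →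
        ∀ g₀ : ℝ, 0 < g₀ → g₀ ≤ gs →
          CutoffQuadHyp (wsawQuadFlow L s) Ω (jOmega (betaPT 4 L s0) Ω) B' c' ⌊c'⁻¹⌋₊ C' (L ^ 2) g₀ := by
  have hL1 : (1 : ℝ) < L := by linarith
  have hΩ0 : 0 < Ω := by linarith
  have hΩ1 : 0 < Ω - 1 := by linarith
  have hθ : (1 / 2 : ℝ) ≤ 1 - (L ^ 2)⁻¹ := by
    have hL4 : (4 : ℝ) ≤ L ^ 2 := by nlinarith
    have hL40 : (0 : ℝ) < L ^ 2 := by positivity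
    have : (L ^ 2)⁻¹ ≤ 1 / 4 := by rw [inv_le_comm₀ hL40 (by norm_num)]; linarith
    linarith
  -- (A1)–(A2) uniformly in the mass, and the stability of the cut-off
  obtain ⟨δ₁, B, c, C, hδ₁, hδ₁1, hA⟩ := hypA1_and_hypA2_wsawQuadFlow hL hΩ
  obtain ⟨δ₂, hδ₂, hδ₂1, D, hD⟩ := jOmega_betaPT_sub_le hL hΩ
  have hA0 := hA 0 le_rfl hδ₁.le
  have hB : 0 ≤ B := hA0.1.B_nonneg
  have hc : 0 < c := hA0.1.c_pos
  have hlam : 1 < L ^ 2 := by nlinarith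
  have hC : 0 ≤ C := by
    have h1 := hA0.2.theta_le 0
    have h2 := (chi_pos_and_le_one (wsawQuadFlow L 0).β hΩ.le 0).1
    by_contra hneg
    push Not at hneg
    have : C * chi (wsawQuadFlow L 0).β Ω 0 < 0 := mul_neg_of_neg_of_pos hneg h2
    linarith [abs_nonneg ((wsawQuadFlow L 0).θ 0)]
  -- the new constants (written out: `B' = BΩ^D`, `C' = CΩ^D`, `c' = min c (1/(N+D+1))`, `N = ⌊c⁻¹⌋₊`)
  obtain ⟨c', hc'def⟩ : ∃ c' : ℝ, c' = min c (1 / ((⌊c⁻¹⌋₊ + D : ℕ) + 1)) := ⟨_, rfl⟩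
  have hc'0 : 0 < c' := by rw [hc'def]; exact lt_min hc (by positivity)
  have hc'c : c' ≤ c := by rw [hc'def]; exact min_le_left _ _
  have hN' : ⌊c⁻¹⌋₊ + D ≤ ⌊c'⁻¹⌋₊ := le_floor_inv_of_le hc'0 (by rw [hc'def]; exact min_le_right _ _)
  have hΩD : 0 ≤ Ω ^ D := by positivity
  have hL21 : 0 < L ^ 2 - 1 := by linarith
  -- the eight smallness constants
  obtain ⟨K1, hK1⟩ : ∃ K : ℝ, K = B * Ω ^ D * 4 := ⟨_, rfl⟩
  obtain ⟨K2, hK2⟩ : ∃ K : ℝ, K = 2 * (B * Ω ^ D) * ((⌊c⁻¹⌋₊ + D : ℕ) + 1 / (Ω - 1)) * 2 := ⟨_, rfl⟩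
  obtain ⟨K3, hK3⟩ : ∃ K : ℝ, K = 4 * (C * Ω ^ D) := ⟨_, rfl⟩
  obtain ⟨K4, hK4⟩ : ∃ K : ℝ, K = 8 * (C * Ω ^ D) * ((⌊c⁻¹⌋₊ + D : ℕ) + 1 / (Ω - 1)) := ⟨_, rfl⟩
  obtain ⟨K5, hK5⟩ : ∃ K : ℝ, K = 2 * (C * Ω ^ D) *
      (1 + 2 * (C * Ω ^ D) * ((1 + (⌊c⁻¹⌋₊ + D : ℕ)) / c + (⌊c⁻¹⌋₊ + D : ℕ) + 2 * Ω / (Ω - 1))) *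
      (2 / (L ^ 2 - 1)) := ⟨_, rfl⟩
  obtain ⟨K6, hK6⟩ : ∃ K : ℝ, K = 2 * (B * Ω ^ D) * (⌊c'⁻¹⌋₊ + 1 / (Ω - 1)) * 2 := ⟨_, rfl⟩
  obtain ⟨K7, hK7⟩ : ∃ K : ℝ, K = 8 * (C * Ω ^ D) * (⌊c'⁻¹⌋₊ + 1 / (Ω - 1)) := ⟨_, rfl⟩
  obtain ⟨K8, hK8⟩ : ∃ K : ℝ, K = 2 * (C * Ω ^ D) *
      (1 + 2 * (C * Ω ^ D) * ((1 + ⌊c'⁻¹⌋₊) / c' + ⌊c'⁻¹⌋₊ + 2 * Ω / (Ω - 1))) * (2 / (L ^ 2 - 1)) := ⟨_, rfl⟩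
  have hK10 : 0 ≤ K1 := by rw [hK1]; positivity
  have hK20 : 0 ≤ K2 := by rw [hK2]; positivity
  have hK30 : 0 ≤ K3 := by rw [hK3]; positivity
  have hK40 : 0 ≤ K4 := by rw [hK4]; positivity
  have hK50 : 0 ≤ K5 := by rw [hK5]; positivity
  have hK60 : 0 ≤ K6 := by rw [hK6]; positivity
  have hK70 : 0 ≤ K7 := by rw [hK7]; positivity
  have hK80 : 0 ≤ K8 := by rw [hK8]; positivity
  -- a common threshold below `quadThreshold`, `1/4` and the `1/(K_i+1)`
  obtain ⟨g1, hg1, hg1a, hg1b⟩ := exists_pos_le_both (quadThreshold_pos (B := B) (C := C) hΩ hc hlam)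
    (by norm_num : (0 : ℝ) < 1 / 4)
  obtain ⟨g2, hg2, hg2a, hg2b⟩ := exists_pos_le_both hg1 (by positivity : (0 : ℝ) < 1 / (K1 + 1))
  obtain ⟨g3, hg3, hg3a, hg3b⟩ := exists_pos_le_both hg2 (by positivity : (0 : ℝ) < 1 / (K2 + 1))
  obtain ⟨g4, hg4', hg4a, hg4b⟩ := exists_pos_le_both hg3 (by positivity : (0 : ℝ) < 1 / (K3 + 1))
  obtain ⟨g5, hg5, hg5a, hg5b⟩ := exists_pos_le_both hg4' (by positivity : (0 : ℝ) < 1 / (K4 + 1))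
  obtain ⟨g6, hg6, hg6a, hg6b⟩ := exists_pos_le_both hg5 (by positivity : (0 : ℝ) < 1 / (K5 + 1))
  obtain ⟨g7, hg7, hg7a, hg7b⟩ := exists_pos_le_both hg6 (by positivity : (0 : ℝ) < 1 / (K6 + 1))
  obtain ⟨g8, hg8, hg8a, hg8b⟩ := exists_pos_le_both hg7 (by positivity : (0 : ℝ) < 1 / (K7 + 1))
  obtain ⟨g9, hg9, hg9a, hg9b⟩ := exists_pos_le_both hg8 (by positivity : (0 : ℝ) < 1 / (K8 + 1))
  have h1D : (1 : ℝ) ≤ Ω ^ D := one_le_pow₀ hΩ.le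
  have hBB : B ≤ B * Ω ^ D := le_mul_of_one_le_right hB h1D
  have hCC : C ≤ C * Ω ^ D := le_mul_of_one_le_right hC h1D
  refine ⟨min δ₁ δ₂, B * Ω ^ D, c', C * Ω ^ D, g9, lt_min hδ₁ hδ₂, (min_le_left _ _).trans hδ₁1, hc'0, hg9,
    fun s hs hsδ => ?_, fun s0 s hs0 hs0δ hs hsδ hclose g₀ hg₀ hg₀s => ?_⟩
  · obtain ⟨hA1, hA2⟩ := hA s hs (hsδ.trans (min_le_left _ _))
    exact ⟨hA1.mono hBB hc'0 hc'c, hA2.mono hΩ.le hc'0 hc'c hCC⟩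
  -- unpack the threshold
  have l8 : g₀ ≤ g8 := hg₀s.trans hg9a
  have l7 : g₀ ≤ g7 := l8.trans hg8a
  have l6 : g₀ ≤ g6 := l7.trans hg7a
  have l5 : g₀ ≤ g5 := l6.trans hg6a
  have l4 : g₀ ≤ g4 := l5.trans hg5a
  have l3 : g₀ ≤ g3 := l4.trans hg4a
  have l2 : g₀ ≤ g2 := l3.trans hg3a
  have l1 : g₀ ≤ g1 := l2.trans hg2a
  have hgq : g₀ ≤ quadThreshold Ω B c C (L ^ 2) := l1.trans hg1a
  have hg4 : g₀ ≤ 1 / 4 := l1.trans hg1b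
  have sm : ∀ {K : ℝ}, 0 ≤ K → g₀ ≤ 1 / (K + 1) → K * g₀ ≤ 1 := fun hK ht =>
    mul_le_of_le_div_add_one hK one_pos ht
  have s1 := sm hK10 (l2.trans hg2b)
  have s2 := sm hK20 (l3.trans hg3b)
  have s3 := sm hK30 (l4.trans hg4b)
  have s4 := sm hK40 (l5.trans hg5b)
  have s5 := sm hK50 (l6.trans hg6b)
  have s6 := sm hK60 (l7.trans hg7b)
  have s7 := sm hK70 (l8.trans hg8b)
  have s8 := sm hK80 (hg₀s.trans hg9b)
  rw [hK1] at s1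
  rw [hK2] at s2
  rw [hK3] at s3
  rw [hK4] at s4
  rw [hK5] at s5
  rw [hK6] at s6
  rw [hK7] at s7
  rw [hK8] at s8
  -- (A1)–(A2) at `s`, the natural cut-off, and its distance to the frozen one
  have hsδ₁ : s ≤ δ₁ := hsδ.trans (min_le_left _ _)
  have hsδ₂ : s ≤ δ₂ := hsδ.trans (min_le_right _ _)
  have hs0δ₂ : s0 ≤ δ₂ := hs0δ.trans (min_le_right _ _)
  obtain ⟨hA1, hA2⟩ := hA s hs.le hsδ₁
  obtain ⟨h, -, -⟩ := cutoffQuadHyp_of_hypA hΩ hA1 hA2 hg₀ hgq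
  obtain ⟨hk1, hk2⟩ := hD (1 / 2) (by norm_num) hθ s s0 hs hsδ₂ hs0 hs0δ₂ hclose
  -- the two `(λ-1)/2`-type conditions
  have hdiv : ∀ {X : ℝ}, 0 ≤ X → X * (2 / (L ^ 2 - 1)) * g₀ ≤ 1 → X * g₀ ≤ (L ^ 2 - 1) / 2 := by
    intro X hX hXg
    have hpos : 0 < 2 / (L ^ 2 - 1) := by positivity
    have e : X * (2 / (L ^ 2 - 1)) * g₀ = (X * g₀) * (2 / (L ^ 2 - 1)) := by ring
    rw [e] at hXg
    have := (le_div_iff₀ hpos).2 hXg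
    calc X * g₀ ≤ 1 / (2 / (L ^ 2 - 1)) := this
      _ = (L ^ 2 - 1) / 2 := by field_simp
  have s5' := hdiv (by positivity) s5
  have s8' := hdiv (by positivity) s8
  -- shift the cut-off from `j_Ω(β(s))` to `k̃ = j_Ω(β(s0))`
  have hshift := h.shift (k' := jOmega (betaPT 4 L s0) Ω) (d := D) hk1 hk2 hg₀ hg4
    (by linarith only [s1]) (by push_cast at s2 ⊢; linarith only [s2]) (by linarith only [s3])
    (by push_cast at s4 ⊢; linarith only [s4]) (by push_cast at s5' ⊢; linarith only [s5'])
  -- weaken to `c'` and `N' = ⌊c'⁻¹⌋₊ ≥ N + D`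
  exact hshift.weaken hc'0 hc'c hN' (by linarith only [s6]) (by linarith only [s7]) (by linarith only [s8'])

end CTWSAW

end Literature.Barriers.CriticalPhenomena
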